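import Mathlib
import Literature.Computability.Complexity.RangeAvoidance
import Literature.Computability.Complexity.SignDegreeXor
import Summits.PneNP.PneNP.Theorems.PstarSALevel
import Summits.PneNP.PneNP.Theorems.PstarSAClosure
import Summits.PneNP.PneNP.Theorems.PstarTyped
import Summits.PneNP.PneNP.Theorems.PstarGapLinearised
import Summits.PneNP.PneNP.Theorems.PstarGapPeeling
import Summits.PneNP.PneNP.Theorems.PstarNoDeadCentre

/-!
# Free centres: `PstarNoDeadCentre.CentreFree` by name (ROUND-24 item T24.15)

FRONTIER range-avoidance ladder, rung F-N3, ROUND 24 (cell `pnp-ideate`; restricted-model proof complexity — nothing here bears on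
`P` versus `NP`).  Paper proof: planner memo ROUND-24-PRESEED §13 R10(j),(k); referee audit AUDIT-r10j-noDeadCentre-g43 (assignment
form N1, avoidance count of the addendum).

**Theorem (`centreFree`).**  On a pure, typed, `(r,3/2)`-boundary-expanding `P⋆` instance with simple overlaps, for every target `y`,
every output set `J` with `|J| ≤ r`, every centre `d` of `J` (an AND-slot variable of two distinct outputs of `J`) and every
`b : Bool` there is an assignment solving all outputs of `J` on `y` with value `b` at `d`.

**Proof (assignment surgery, `claim`).**  Fix `y, J, d, b`; by strong induction on `K ⊆ J` we build `z` solving `K` with `z d = b`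
(`K = ∅`: the constant assignment).  `d` is an AND-slot variable, hence (typed) never an XOR-slot variable.
* CASE A — some output `g ∈ K` has an XOR slot read by no other output of `K`: solve `K ∖ g`, then flip that slot if `g` is wrong
  (`PstarGapPeeling.eval_update_xor_slot`); nothing else in `K` reads it and it is not `d`.
* CASE B — otherwise (`K` is TIP-FREE: both XOR variables of every output are read elsewhere in `K`).  Then `|K| ≥ 3`: a singleton is
  not tip-free, and two tip-free outputs would share both XOR variables, against simple overlaps.  Boundary variables of `K` are read
  once, so they are AND-slot variables; `(r,3/2)`-expansion of `K` gives `|bdry K| ≥ 3|K|/2 ≥ |K| + 2`, hence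
  `|bdry K ∖ {d}| > |K|`, and the peeling pigeonhole `PstarSAClosure.exists_two_private` (with `T = {d}`) yields `g ∈ K` owning two
  boundary variables other than `d` — necessarily its AND pair.  Solve `K ∖ g` and set that pair to `(c,c)` with
  `c = y_g ⊕ z_u ⊕ z_v` (`PstarGapPeeling.eval_update_and_pair`); the pair is private and avoids `d`.
`MaxDegree` is not used; `SimpleOverlap` only in the `|K| ≥ 3` step.
-/

set_option linter.dupNamespace false -- `Summit.PneNP.PneNP.…`: summit = sub-problem name (D-0017 single-conjunct layout)

open Finset Literature.Computability.Complexity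
open Summit.PneNP.PneNP.Theorems.PstarTyped (Typed)
open Summit.PneNP.PneNP.Theorems.PstarSALevel (varSet bdry BoundaryExpanding SimpleOverlap)
open Summit.PneNP.PneNP.Theorems.PstarSAClosure (exists_two_private)
open Summit.PneNP.PneNP.Theorems.PstarGapLinearised (andPair)
open Summit.PneNP.PneNP.Theorems.PstarGapPeeling (not_mem_varSet_of_private eval_update_of_not_mem eval_update_xor_slot
  eval_update_and_pair)
open Summit.PneNP.PneNP.Theorems.PstarNoDeadCentre (IsCentre CentreFree)

namespace Summit.PneNP.PneNP.Theorems.PstarCentreFree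

variable {n m : ℕ}

/-- A slot variable lies in the variable set. -/
theorem vars_mem_varSet (I : LocalMap 4 n m) (j : Fin m) (s : Fin 4) : I.vars j s ∈ varSet I j := by
  unfold PstarSALevel.varSet
  exact mem_image.2 ⟨s, mem_univ _, rfl⟩

/-- **The surgery claim.**  For a pure expanding instance with simple overlaps, a target `y`, a set `J` of at most `r` outputs,
a variable `d` lying in no XOR slot, and `b : Bool`: every `K ⊆ J` is solved by an assignment taking the value `b` at `d`. -/
theorem claim (I : LocalMap 4 n m) (hI : I.IsPure xorAndPred) {r : ℕ} (hB : BoundaryExpanding r I)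
    (hS : SimpleOverlap I) (y : Fin m → Bool) (J : Finset (Fin m)) (hJr : J.card ≤ r) (d : Fin n)
    (hdX : ∀ (g : Fin m) (s : Fin 4), s.val < 2 → I.vars g s ≠ d) (b : Bool) :
    ∀ K : Finset (Fin m), K ⊆ J → ∃ z : Fin n → Bool, (∀ j ∈ K, I.eval z j = y j) ∧ z d = b := by
  classical
  intro K
  induction K using Finset.strongInduction with
  | H K ih =>
    intro hKJ
    rcases K.eq_empty_or_nonempty with rfl | hne
    · exact ⟨fun _ => b, fun j hj => absurd hj (notMem_empty _), rfl⟩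
    have hKr : K.card ≤ r := (card_le_card hKJ).trans hJr
    by_cases hA : ∃ g ∈ K, ∃ s : Fin 4, s.val < 2 ∧ ∀ g' ∈ K, g' ≠ g → I.vars g s ∉ varSet I g'
    · -- CASE A: a private XOR slot
      obtain ⟨g, hg, s, hs, hpriv⟩ := hA
      obtain ⟨z, hz, hzd⟩ := ih (K.erase g) (erase_ssubset hg) ((erase_subset _ _).trans hKJ)
      by_cases hok : I.eval z g = y g
      · exact ⟨z, fun j hj => if h : j = g then by rw [h]; exact hok else hz j (mem_erase.2 ⟨h, hj⟩), hzd⟩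
      refine ⟨Function.update z (I.vars g s) (!z (I.vars g s)), fun j hj => ?_, ?_⟩
      · by_cases h : j = g
        · subst h
          rw [eval_update_xor_slot I hI z j s hs]
          revert hok
          cases I.eval z j <;> cases y j <;> simp
        · rw [eval_update_of_not_mem I j z (hpriv j hj h)]
          exact hz j (mem_erase.2 ⟨h, hj⟩)
      · rw [Function.update_of_ne (hdX g s hs).symm]
        exact hzd
    · -- CASE B: tip-free
      push Not at hA
      -- `|K| ≥ 3`
      obtain ⟨g₀, hg₀⟩ := hne
      have hK3 : 3 ≤ K.card := by
        by_contra hlt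
        push Not at hlt
        obtain ⟨g₁, hg₁, hne₁, hm₁⟩ := hA g₀ hg₀ 0 (by decide)
        obtain ⟨g₂, hg₂, hne₂, hm₂⟩ := hA g₀ hg₀ 1 (by decide)
        have h12 : g₁ = g₂ := by
          have hc : (K.erase g₀).card ≤ 1 := by rw [card_erase_of_mem hg₀]; omega
          exact card_le_one.1 hc g₁ (mem_erase.2 ⟨hne₁, hg₁⟩) g₂ (mem_erase.2 ⟨hne₂, hg₂⟩)
        subst h12
        have h01 : I.vars g₀ 0 ≠ I.vars g₀ 1 := fun h => absurd (hI.2 g₀ h) (by decide)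
        have hsub : ({I.vars g₀ 0, I.vars g₀ 1} : Finset (Fin n)) ⊆ varSet I g₀ ∩ varSet I g₁ := by
          intro v hv
          rw [mem_insert, mem_singleton] at hv
          rw [mem_inter]
          rcases hv with rfl | rfl
          · exact ⟨vars_mem_varSet I g₀ 0, hm₁⟩
          · exact ⟨vars_mem_varSet I g₀ 1, hm₂⟩
        have := (card_le_card hsub).trans (hS g₀ g₁ (Ne.symm hne₁))
        rw [card_pair h01] at this
        omega
      -- the pigeonhole outside `{d}`
      have hexp := hB K hKr
      have hlt : K.card < (bdry I K \ {d}).card := by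
        have := card_le_card_sdiff_add_card (s := bdry I K) (t := {d})
        rw [card_singleton] at this
        omega
      obtain ⟨g, hg, hP⟩ := exists_two_private I K {d} hlt
      -- the two private variables outside `{d}` are the AND pair of `g`
      have hPsub : ((bdry I K \ {d}).filter fun v => v ∈ varSet I g) ⊆ {I.vars g 2, I.vars g 3} := by
        intro v hv
        obtain ⟨hv1, hv2⟩ := mem_filter.1 hv
        obtain ⟨hvb, -⟩ := mem_sdiff.1 hv1
        have hv3 := hv2
        unfold PstarSALevel.varSet at hv3
        obtain ⟨s, -, rfl⟩ := mem_image.1 hv3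
        rw [mem_insert, mem_singleton]
        have hs2 : 2 ≤ s.val := by
          by_contra hs
          push Not at hs
          obtain ⟨g', hg', hne', hm'⟩ := hA g hg s hs
          exact not_mem_varSet_of_private I hg hg' hne' hvb hv2 hm'
        have : s = 2 ∨ s = 3 := by fin_cases s <;> simp at hs2 ⊢
        rcases this with rfl | rfl
        · exact Or.inl rfl
        · exact Or.inr rfl
      have hPeq : ((bdry I K \ {d}).filter fun v => v ∈ varSet I g) = {I.vars g 2, I.vars g 3} :=
        eq_of_subset_of_card_le hPsub ((card_insert_le _ _).trans (by rw [card_singleton]; exact hP))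
      have h2P : I.vars g 2 ∈ (bdry I K \ {d}).filter fun v => v ∈ varSet I g := by rw [hPeq]; simp
      have h3P : I.vars g 3 ∈ (bdry I K \ {d}).filter fun v => v ∈ varSet I g := by rw [hPeq]; simp
      have hmemP : ∀ {v}, v ∈ ((bdry I K \ {d}).filter fun v => v ∈ varSet I g) →
          v ∈ bdry I K ∧ v ≠ d ∧ v ∈ varSet I g := fun hv => by
        obtain ⟨hv1, hv2⟩ := mem_filter.1 hv
        obtain ⟨hvb, hvd⟩ := mem_sdiff.1 hv1
        exact ⟨hvb, fun h => hvd (mem_singleton.2 h), hv2⟩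
      obtain ⟨h2b, h2d, h2v⟩ := hmemP h2P
      obtain ⟨h3b, h3d, h3v⟩ := hmemP h3P
      -- solve the rest and patch through the AND pair
      obtain ⟨z, hz, hzd⟩ := ih (K.erase g) (erase_ssubset hg) ((erase_subset _ _).trans hKJ)
      obtain ⟨c, hc⟩ : ∃ c : Bool, c = xor (xor (z (I.vars g 0)) (z (I.vars g 1))) (y g) := ⟨_, rfl⟩
      refine ⟨Function.update (Function.update z (I.vars g 2) c) (I.vars g 3) c, fun j hj => ?_, ?_⟩
      · by_cases h : j = g
        · subst h
          rw [eval_update_and_pair I hI z j c, hc]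
          cases z (I.vars j 0) <;> cases z (I.vars j 1) <;> cases y j <;> rfl
        · rw [eval_update_of_not_mem I j _ (not_mem_varSet_of_private I hg hj h h3b h3v),
            eval_update_of_not_mem I j _ (not_mem_varSet_of_private I hg hj h h2b h2v)]
          exact hz j (mem_erase.2 ⟨h, hj⟩)
      · rw [Function.update_of_ne h3d.symm, Function.update_of_ne h2d.symm]
        exact hzd

/-- **T24.15 — `CentreFree` by name.**  Every centre of a small output set takes both values among the solutions (no dead and no
forced centre), on pure typed `(r,3/2)`-boundary-expanding instances with simple overlaps.  FRONTIER; nothing here bears on `P`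
versus `NP`. -/
theorem centreFree : CentreFree := by
  intro n m r I hI hT hB hS y J hJr d hd b
  obtain ⟨j₁, _, _, _, _, hd₁, _⟩ := hd
  have hdX : ∀ (g : Fin m) (s : Fin 4), s.val < 2 → I.vars g s ≠ d := by
    intro g s hs h
    unfold PstarGapLinearised.andPair at hd₁
    rw [mem_insert, mem_singleton] at hd₁
    rcases hd₁ with e | e
    · exact hT g j₁ s 2 hs (by decide) (h.trans e)
    · exact hT g j₁ s 3 hs (by decide) (h.trans e)
  exact claim I hI hB hS y J hJr d hdX b J Subset.rfl

end Summit.PneNP.PneNP.Theorems.PstarCentreFree
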